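import Summits.QuantumFields.YangMills.Theorems.UnitScaleTiltProp7CovPinnedKernelL1OfRows
import Summits.QuantumFields.YangMills.Theorems.UnitScaleTiltProp7CovAgmonDecay
import HarnessLib

/-!
# Route `UnitScaleTilt`, crux K1 «MinimiserStabilityRegPr» (stmt-QuantumFields-19200), route-R E′ path (α′), (E1-b) at the CURVED background, P-cov2 row (A-door-cov), part 2:
# THE COVARIANT DOOR WITH THE COVARIANT AGMON ESTIMATE PLUGGED IN — `Σ_z √hs(Δ_U(V − U_int)(z)) ≤ W·(3N_h + 2(g₁+γA′)N_ht + 2A′N_s) + N₂ + N₃ + W·3N₄` from the seven numbers of the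
# flat door ✓ `Prop7PinnedKernelL1OfRows` read in `hs` letters, the weight∕Poincaré∕window rows of routeR-w6 g6's ★★★ `Prop7CovAgmonDecay.weighted_covLaplace_le_core` VERBATIM,
# and an `hEL` identity for the free far field `(1−χ)•V` with ANY sources (peeled: ✓ `Prop7CovPinnedPeelingEL.el_of_peeled_cov`; TYPE-1 for a compactly supported transplant:
# `h := Δ_U((1−χ)•V)`, `ht = s = 0`, second theorem) — the covariant twin of ✓p663210 `sum_abs_laplace_sub_interp_le_of_rows`

Cell `ym3-torus`, width seat `ym3-torus-px22` (gen 2), on ★routeR-w3 g6's word «px22 g2: (A-door-cov) LOCATE → brick» (21:47:43Z) and routeR-w6 g6's LOCATE-PCOV2 v1.2 §5; LOCATE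
19200 evidence `LOCATE-ADOORCOV-px22g2.md` (b4fc5e92eeacdffd) §4.  `--supports stmt-QuantumFields-19200`, count-neutral.  THEOREMS ONLY (0 `def`, 0 `sorry`).  YM₃ on T³ is a ladder
rung (R3), not the Clay problem; nothing here claims the stub, the crux, d = 4 or the gap.

WHAT IS PROVED (ns `…Theorems.Prop7CovPinnedKernelL1OfRowsCore`; torus `Site P i`, unitary `U`, `Δ_Uf x = divB T U (fun μ => covD T U μ f) x`, `hs` spelled out, letters `p γ A′ g₁ τ`,
windows `H1 H2` exactly as in `weighted_covLaplace_le_core`).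
* §1 `coeffs_nonneg` (`0 ≤ γ`, `0 ≤ A′`, `0 ≤ g₁` from their defining equations), `sum_hs_zero`, `interp_el_type_one` (the near interpolation error `u − U₂` satisfies the core's
  `hEL` with `h := Δ_Uu`, `ht := 0`, `s := 0`).
* §2 ★★★ `sum_sqrt_hs_covLaplace_sub_interp_le_of_rows_cov` — the general door (sources `h ht s` of `(1−χ)•V` displayed as ONE identity `hELF`).
* §3 ★★★ `sum_sqrt_hs_covLaplace_sub_interp_le_type_one` — the TYPE-1 door: `Σ_z √hs(Δ_U(V − U_int) z) ≤ W·3N_h + N₂ + N₃ + W·3N₄` with `N_h ≥ √Σω²hs(Δ_U((1−χ)•V))`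
  (routeR-w6 g6 §5 (a): for a transplant `V` supported in the `3ℓ`-ball, `(1−χ₀)•V` lives on an annulus and IS a localised type-1 source — no commutator bookkeeping).
HONEST SCOPE.  Assembly only: every analytic input is a displayed NUMBER or one of routeR-w6 g6's rows; (N-cov) — the framed transplant that produces `V`, `u`, and the seven numbers at
scale `ℓ = L^k` with `(1+O(e))` constants — is LOCATE-PCOV2 §5 (two generations), not this file.

References: T. Bałaban, CMP 99 (1985) 389–434 [Balaban1985BackgroundPropagators] ((3.8) p.392); CMP 96 (1984) 223–250 [Balaban1984PropagatorsII] ((1.9) p.226, (2.61) p.234);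
CMP 99 (1985) 75–102 [Balaban1985RegularSpaces] ((1.14) p.78, (1.36) p.82); CMP 102 (1985) 277–309 [Balaban1985Variational] (Prop. 7 p.299).
-/

set_option autoImplicit false

noncomputable section

open scoped BigOperators Matrix

namespace Summit.QuantumFields.YangMills.Theorems.Prop7CovPinnedKernelL1OfRowsCore

open Literature.MathematicalPhysics.QuantumFieldTheory.Balaban1983to89
open B9Eq39Adjoint (R R_def covD covDstar divB)
open B9TorusCalculus (torusT torusT_apply torusT_symm_apply)
open Summit.QuantumFields.YangMills.Theorems.Prop7CovAgmonDecay (weighted_covLaplace_le_core)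
open Summit.QuantumFields.YangMills.Theorems.Prop7CovPinnedPeelingEL (sum_re_trace_covLaplace_sub_biharmonic)
open Summit.QuantumFields.YangMills.Theorems.Prop7CovPinnedKernelL1OfRows (far_vanishes_on far_el_of_sources el_type_one
  sum_sqrt_hs_covLaplace_sub_interp_le_of_far_rows)

variable {P : Params} {i : ℕ} {N : ℕ}
variable {U : Fin P.d → Site P i → (Matrix (Fin N) (Fin N) ℂ)ˣ}

/-! ## §1 Letters -/

omit U in
/-- the core's coefficients are nonnegative: `0 ≤ γ`, `0 ≤ A′`, `0 ≤ g₁`. [cite: Balaban1984PropagatorsII, (1.9) p.226] -/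
theorem coeffs_nonneg {a A p γ A' g₁ : ℝ} (ha0 : 0 ≤ a) (hA : 0 ≤ A)
    (hγ : γ = 15 / 4 * a * Real.sqrt P.d) (hA' : A' = 2 * A + 4 * p ^ 2) (hg₁ : g₁ = Real.sqrt (2 * A' + γ ^ 2 * A' ^ 2)) :
    0 ≤ γ ∧ 0 ≤ A' ∧ 0 ≤ g₁ := by
  refine ⟨?_, ?_, ?_⟩
  · rw [hγ]; positivity
  · rw [hA']; positivity
  · rw [hg₁]; exact Real.sqrt_nonneg _

omit U in
/-- `Σ_x ω²·hs(0) = 0` and `Σ_xΣ_μ ω²·hs(0) = 0`. [folklore] -/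
theorem sum_hs_zero (ω : Site P i → ℝ) :
    (∑ x : Site P i, ω x ^ 2 * ∑ j : Fin N, ∑ k : Fin N, ‖(0 : Matrix (Fin N) (Fin N) ℂ) j k‖ ^ 2) = 0
      ∧ (∑ x : Site P i, ∑ _μ : Fin P.d, ω x ^ 2 * ∑ j : Fin N, ∑ k : Fin N, ‖(0 : Matrix (Fin N) (Fin N) ℂ) j k‖ ^ 2) = 0 := by
  constructor <;> simp

/-- **THE NEAR INTERPOLATION ERROR IS A TYPE-1 INSTANCE**: for `U₂` `Δ_U`-biharmonic off `C` and `v` pinned, `Σ⟨Δ_U(u − U₂), Δ_Uv⟩ = Σ⟨Δ_Uu, Δ_Uv⟩ + ΣΣ⟨0, D_μv⟩ + Σ⟨0, v⟩`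
(unitary `U`). [cite: Balaban1985RegularSpaces, (1.14) p.78] -/
theorem interp_el_type_one (hU : ∀ ν x, (U ν x : Matrix (Fin N) (Fin N) ℂ) ∈ unitary (Matrix (Fin N) (Fin N) ℂ))
    (C : Set (Site P i)) (u U₂ : Site P i → Matrix (Fin N) (Fin N) ℂ)
    (hU₂el : ∀ x ∉ C, divB (torusT P i) U (fun μ => covD (torusT P i) U μ
      (fun y => divB (torusT P i) U (fun ν => covD (torusT P i) U ν U₂) y)) x = 0) :
    ∀ v : Site P i → Matrix (Fin N) (Fin N) ℂ, (∀ y ∈ C, v y = 0) →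
      ∑ x, (((divB (torusT P i) U (fun μ => covD (torusT P i) U μ (fun y => u y - U₂ y)) x)ᴴ
          * divB (torusT P i) U (fun μ => covD (torusT P i) U μ v) x).trace).re
        = ∑ x, (((divB (torusT P i) U (fun μ => covD (torusT P i) U μ u) x)ᴴ
            * divB (torusT P i) U (fun μ => covD (torusT P i) U μ v) x).trace).re
          + ∑ x, ∑ μ, (((0 : Matrix (Fin N) (Fin N) ℂ)ᴴ * covD (torusT P i) U μ v x).trace).re
          + ∑ x, (((0 : Matrix (Fin N) (Fin N) ℂ)ᴴ * v x).trace).re := by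
  intro v hv
  rw [sum_re_trace_covLaplace_sub_biharmonic hU C u U₂ hU₂el v hv]
  simp

/-! ## §2 ★★★ The general covariant door -/

/-- ★★★ **THE COVARIANT KERNEL'S `hs`-ℓ¹ MASS FROM SEVEN NUMBERS** (the covariant twin of ✓p663210).  Torus `Site P i`, unitary `U`, centres `C`.  DATA: a real cutoff `χ`, a matrix datum `V`
with pinned `Δ_U`-biharmonic interpolant `U_int` (`hUC hUel`), a near datum `u` with `u|_C = (χ•V)|_C` and pinned interpolant `U₂` (`hU₂C hU₂el`); an `hEL` identity `hELF` for the free far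
field `(1−χ)•V` with sources `h ht s`; routeR-w6 g6's weight∕Poincaré∕window rows VERBATIM (`hω₀ hω₁ hω₂ hP hp hγ hA' hg₁ hτ H1 H2`); and seven numbers
`√Σω²hs(h) ≤ N_h`, `√ΣΣω²hs(ht) ≤ N_ht`, `√Σω²hs(s) ≤ N_s`, `√Σω⁻² ≤ W`, `Σ√hs(Δ_U(χ•V)) ≤ N₂`, `Σ√hs(Δ_Uu) ≤ N₃`, `√Σω²hs(Δ_Uu) ≤ N₄`.
THEN `Σ_z √hs(Δ_U(V − U_int) z) ≤ W·(3N_h + 2(g₁+γA′)N_ht + 2A′N_s) + N₂ + N₃ + W·(3N₄)`.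
[cite: Balaban1984PropagatorsII, (1.9) p.226; Balaban1985RegularSpaces, (1.36) p.82; Balaban1985BackgroundPropagators, (3.8) p.392; Balaban1985Variational, Prop. 7 p.299] -/
theorem sum_sqrt_hs_covLaplace_sub_interp_le_of_rows_cov (hU : ∀ ν x, (U ν x : Matrix (Fin N) (Fin N) ℂ) ∈ unitary (Matrix (Fin N) (Fin N) ℂ))
    (C : Set (Site P i)) (χ ω : Site P i → ℝ) (V Ui u U₂ h s : Site P i → Matrix (Fin N) (Fin N) ℂ) (ht : Fin P.d → Site P i → Matrix (Fin N) (Fin N) ℂ)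
    {a b A p γ A' g₁ τ W Nh Nht Ns N₂ N₃ N₄ : ℝ} (ha0 : 0 ≤ a) (ha : a ≤ 1 / 2) (hb0 : 0 ≤ b) (hA : 0 ≤ A)
    -- the objects
    (hUC : ∀ x ∈ C, Ui x = V x)
    (hUel : ∀ x ∉ C, divB (torusT P i) U (fun μ => covD (torusT P i) U μ
      (fun y => divB (torusT P i) U (fun ν => covD (torusT P i) U ν Ui) y)) x = 0)
    (hu : ∀ x ∈ C, u x = χ x • V x)
    (hU₂C : ∀ x ∈ C, U₂ x = u x)
    (hU₂el : ∀ x ∉ C, divB (torusT P i) U (fun μ => covD (torusT P i) U μ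
      (fun y => divB (torusT P i) U (fun ν => covD (torusT P i) U ν U₂) y)) x = 0)
    (hELF : ∀ v : Site P i → Matrix (Fin N) (Fin N) ℂ, (∀ y ∈ C, v y = 0) →
      ∑ x, (((divB (torusT P i) U (fun μ => covD (torusT P i) U μ (fun y => (1 - χ y) • V y)) x)ᴴ
          * divB (torusT P i) U (fun μ => covD (torusT P i) U μ v) x).trace).re
        = ∑ x, (((h x)ᴴ * divB (torusT P i) U (fun μ => covD (torusT P i) U μ v) x).trace).re
          + ∑ x, ∑ μ, (((ht μ x)ᴴ * covD (torusT P i) U μ v x).trace).re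
          + ∑ x, (((s x)ᴴ * v x).trace).re)
    -- the weight, the Poincaré row, the window (routeR-w6 g6's letters verbatim)
    (hω₀ : ∀ x, 0 < ω x)
    (hω₁ : ∀ x μ, |ω (x.shift μ) - ω x| ≤ a * ω x ∧ |ω (x.unshift μ) - ω x| ≤ a * ω x)
    (hω₂ : ∀ x μ, |ω (x.shift μ) + ω (x.unshift μ) - 2 * ω x| ≤ b * ω x)
    (hP : ∀ v : Site P i → Matrix (Fin N) (Fin N) ℂ, (∀ y ∈ C, v y = 0) →
      Real.sqrt (∑ x, ∑ j : Fin N, ∑ k : Fin N, ‖(v x) j k‖ ^ 2)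
        ≤ A * Real.sqrt (∑ x, ∑ j : Fin N, ∑ k : Fin N, ‖(divB (torusT P i) U (fun μ => covD (torusT P i) U μ v) x) j k‖ ^ 2))
    (hp : p = Real.sqrt (10 * P.d) * A * a) (hγ : γ = 15 / 4 * a * Real.sqrt P.d) (hA' : A' = 2 * A + 4 * p ^ 2)
    (hg₁ : g₁ = Real.sqrt (2 * A' + γ ^ 2 * A' ^ 2))
    (hτ : τ = Real.sqrt (10 * P.d) * (5 / 2 * a) * g₁ + Real.sqrt 3 * P.d * (2 * a ^ 2 + 2 * b) * A')
    (H1 : p * γ + Real.sqrt 3 * P.d * b * A ≤ 1 / 4) (H2 : τ ≤ 1 / 2)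
    -- the seven numbers
    (hNh : Real.sqrt (∑ x, ω x ^ 2 * ∑ j : Fin N, ∑ k : Fin N, ‖(h x) j k‖ ^ 2) ≤ Nh)
    (hNht : Real.sqrt (∑ x, ∑ μ, ω x ^ 2 * ∑ j : Fin N, ∑ k : Fin N, ‖(ht μ x) j k‖ ^ 2) ≤ Nht)
    (hNs : Real.sqrt (∑ x, ω x ^ 2 * ∑ j : Fin N, ∑ k : Fin N, ‖(s x) j k‖ ^ 2) ≤ Ns)
    (hW : Real.sqrt (∑ z, (ω z)⁻¹ ^ 2) ≤ W)
    (hN₂ : ∑ z, Real.sqrt (∑ j : Fin N, ∑ k : Fin N, ‖(divB (torusT P i) U (fun μ => covD (torusT P i) U μ (fun y => χ y • V y)) z) j k‖ ^ 2) ≤ N₂)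
    (hN₃ : ∑ z, Real.sqrt (∑ j : Fin N, ∑ k : Fin N, ‖(divB (torusT P i) U (fun μ => covD (torusT P i) U μ u) z) j k‖ ^ 2) ≤ N₃)
    (hN₄ : Real.sqrt (∑ x, ω x ^ 2 * ∑ j : Fin N, ∑ k : Fin N, ‖(divB (torusT P i) U (fun μ => covD (torusT P i) U μ u) x) j k‖ ^ 2) ≤ N₄) :
    ∑ z, Real.sqrt (∑ j : Fin N, ∑ k : Fin N, ‖(divB (torusT P i) U (fun μ => covD (torusT P i) U μ (fun y => V y - Ui y)) z) j k‖ ^ 2)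
      ≤ W * (3 * Nh + 2 * (g₁ + γ * A') * Nht + 2 * A' * Ns) + N₂ + N₃ + W * (3 * N₄) := by
  obtain ⟨hγ0, hA'0, hg₁0⟩ := coeffs_nonneg (P := P) ha0 hA hγ hA' hg₁
  -- (T1): the far bracket through the core
  have he₁ := far_vanishes_on C χ V Ui u U₂ hUC hu hU₂C
  have hEL₁ := far_el_of_sources hU C χ V Ui U₂ h s ht hUel hU₂el hELF
  have hcore₁ := (weighted_covLaplace_le_core hU C ω (fun x => (1 - χ x) • V x - (Ui x - U₂ x)) h s ht ha0 ha hb0 hA hω₀ hω₁ hω₂ hP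
    he₁ hEL₁ hp hγ hA' hg₁ hτ H1 H2).1
  have hB₁ : Real.sqrt (∑ x, ω x ^ 2 * ∑ j : Fin N, ∑ k : Fin N,
      ‖(divB (torusT P i) U (fun μ => covD (torusT P i) U μ (fun y => (1 - χ y) • V y - (Ui y - U₂ y))) x) j k‖ ^ 2)
        ≤ 3 * Nh + 2 * (g₁ + γ * A') * Nht + 2 * A' * Ns := by
    refine hcore₁.trans ?_
    have h2 : 0 ≤ 2 * (g₁ + γ * A') := by positivity
    have h3 : 0 ≤ 2 * A' := by positivity
    nlinarith [mul_le_mul_of_nonneg_left hNht h2, mul_le_mul_of_nonneg_left hNs h3, hNh]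
  -- (T4): the near interpolation error through the core, type-1
  have he₄ : ∀ y ∈ C, (fun x => u x - U₂ x) y = 0 := fun y hy => by simp [hU₂C y hy]
  have hEL₄ := interp_el_type_one hU C u U₂ hU₂el
  have hcore₄ := (weighted_covLaplace_le_core hU C ω (fun x => u x - U₂ x)
    (fun x => divB (torusT P i) U (fun μ => covD (torusT P i) U μ u) x) (fun _ => 0) (fun _ _ => 0) ha0 ha hb0 hA hω₀ hω₁ hω₂ hP
    he₄ hEL₄ hp hγ hA' hg₁ hτ H1 H2).1
  obtain ⟨hz1, hz2⟩ := sum_hs_zero (P := P) (i := i) (N := N) ω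
  have hB₄ : Real.sqrt (∑ x, ω x ^ 2 * ∑ j : Fin N, ∑ k : Fin N,
      ‖(divB (torusT P i) U (fun μ => covD (torusT P i) U μ (fun y => u y - U₂ y)) x) j k‖ ^ 2) ≤ 3 * N₄ := by
    refine hcore₄.trans ?_
    simp only [hz1, hz2, Real.sqrt_zero, mul_zero, add_zero]
    linarith
  -- the door
  exact sum_sqrt_hs_covLaplace_sub_interp_le_of_far_rows χ V Ui u U₂ ω hω₀ hW hB₁ hN₂ hN₃ hB₄

/-! ## §3 ★★★ The type-1 covariant door (compactly supported transplant) -/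

/-- ★★★ **THE TYPE-1 COVARIANT DOOR** (routeR-w6 g6 LOCATE-PCOV2 §5 (a)): same data without sources — if `√Σω²hs(Δ_U((1−χ)•V)) ≤ N_h` (the far field of a COMPACTLY SUPPORTED `V` is itself
a localised type-1 source) then `Σ_z √hs(Δ_U(V − U_int) z) ≤ W·(3N_h) + N₂ + N₃ + W·(3N₄)`.
[cite: Balaban1984PropagatorsII, (1.9) p.226; Balaban1985RegularSpaces, (1.36) p.82; Balaban1985BackgroundPropagators, (3.8) p.392] -/
theorem sum_sqrt_hs_covLaplace_sub_interp_le_type_one (hU : ∀ ν x, (U ν x : Matrix (Fin N) (Fin N) ℂ) ∈ unitary (Matrix (Fin N) (Fin N) ℂ))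
    (C : Set (Site P i)) (χ ω : Site P i → ℝ) (V Ui u U₂ : Site P i → Matrix (Fin N) (Fin N) ℂ)
    {a b A p γ A' g₁ τ W Nh N₂ N₃ N₄ : ℝ} (ha0 : 0 ≤ a) (ha : a ≤ 1 / 2) (hb0 : 0 ≤ b) (hA : 0 ≤ A)
    (hUC : ∀ x ∈ C, Ui x = V x)
    (hUel : ∀ x ∉ C, divB (torusT P i) U (fun μ => covD (torusT P i) U μ
      (fun y => divB (torusT P i) U (fun ν => covD (torusT P i) U ν Ui) y)) x = 0)
    (hu : ∀ x ∈ C, u x = χ x • V x)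
    (hU₂C : ∀ x ∈ C, U₂ x = u x)
    (hU₂el : ∀ x ∉ C, divB (torusT P i) U (fun μ => covD (torusT P i) U μ
      (fun y => divB (torusT P i) U (fun ν => covD (torusT P i) U ν U₂) y)) x = 0)
    (hω₀ : ∀ x, 0 < ω x)
    (hω₁ : ∀ x μ, |ω (x.shift μ) - ω x| ≤ a * ω x ∧ |ω (x.unshift μ) - ω x| ≤ a * ω x)
    (hω₂ : ∀ x μ, |ω (x.shift μ) + ω (x.unshift μ) - 2 * ω x| ≤ b * ω x)
    (hP : ∀ v : Site P i → Matrix (Fin N) (Fin N) ℂ, (∀ y ∈ C, v y = 0) →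
      Real.sqrt (∑ x, ∑ j : Fin N, ∑ k : Fin N, ‖(v x) j k‖ ^ 2)
        ≤ A * Real.sqrt (∑ x, ∑ j : Fin N, ∑ k : Fin N, ‖(divB (torusT P i) U (fun μ => covD (torusT P i) U μ v) x) j k‖ ^ 2))
    (hp : p = Real.sqrt (10 * P.d) * A * a) (hγ : γ = 15 / 4 * a * Real.sqrt P.d) (hA' : A' = 2 * A + 4 * p ^ 2)
    (hg₁ : g₁ = Real.sqrt (2 * A' + γ ^ 2 * A' ^ 2))
    (hτ : τ = Real.sqrt (10 * P.d) * (5 / 2 * a) * g₁ + Real.sqrt 3 * P.d * (2 * a ^ 2 + 2 * b) * A')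
    (H1 : p * γ + Real.sqrt 3 * P.d * b * A ≤ 1 / 4) (H2 : τ ≤ 1 / 2)
    (hNh : Real.sqrt (∑ x, ω x ^ 2 * ∑ j : Fin N, ∑ k : Fin N,
      ‖(divB (torusT P i) U (fun μ => covD (torusT P i) U μ (fun y => (1 - χ y) • V y)) x) j k‖ ^ 2) ≤ Nh)
    (hW : Real.sqrt (∑ z, (ω z)⁻¹ ^ 2) ≤ W)
    (hN₂ : ∑ z, Real.sqrt (∑ j : Fin N, ∑ k : Fin N, ‖(divB (torusT P i) U (fun μ => covD (torusT P i) U μ (fun y => χ y • V y)) z) j k‖ ^ 2) ≤ N₂)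
    (hN₃ : ∑ z, Real.sqrt (∑ j : Fin N, ∑ k : Fin N, ‖(divB (torusT P i) U (fun μ => covD (torusT P i) U μ u) z) j k‖ ^ 2) ≤ N₃)
    (hN₄ : Real.sqrt (∑ x, ω x ^ 2 * ∑ j : Fin N, ∑ k : Fin N, ‖(divB (torusT P i) U (fun μ => covD (torusT P i) U μ u) x) j k‖ ^ 2) ≤ N₄) :
    ∑ z, Real.sqrt (∑ j : Fin N, ∑ k : Fin N, ‖(divB (torusT P i) U (fun μ => covD (torusT P i) U μ (fun y => V y - Ui y)) z) j k‖ ^ 2)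
      ≤ W * (3 * Nh) + N₂ + N₃ + W * (3 * N₄) := by
  obtain ⟨hz1, hz2⟩ := sum_hs_zero (P := P) (i := i) (N := N) ω
  have h := sum_sqrt_hs_covLaplace_sub_interp_le_of_rows_cov hU C χ ω V Ui u U₂
    (fun x => divB (torusT P i) U (fun μ => covD (torusT P i) U μ (fun y => (1 - χ y) • V y)) x) (fun _ => 0) (fun _ _ => 0)
    (Nht := 0) (Ns := 0) ha0 ha hb0 hA hUC hUel hu hU₂C hU₂el (el_type_one C χ V) hω₀ hω₁ hω₂ hP hp hγ hA' hg₁ hτ H1 H2 hNh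
    (by rw [hz2, Real.sqrt_zero]) (by rw [hz1, Real.sqrt_zero]) hW hN₂ hN₃ hN₄
  simpa only [mul_zero, add_zero] using h

end Summit.QuantumFields.YangMills.Theorems.Prop7CovPinnedKernelL1OfRowsCore

end
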